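import Summits.Langlands.Langlands.Theses.FifteenLocusEisenstein
import HarnessLib

/-!
# `FifteenLocusEisenstein.TargetOfCruxes` (stmt-Langlands-15890) — the body of `closes`, proved

[proof of `Summit.Langlands.Langlands.Theses.FifteenLocusEisenstein.TargetOfCruxes`
(route `FifteenLocusEisenstein`, support item, rank 9): `IrreducibleFiveModular →
NonOrdinaryEisensteinModular → UnorientedOrdinaryModular → ReducibleOrdinaryModular →
OrientedOrdinaryOfEngine → Target`]

Pure logic — the route's deciding theorem `closes` with the sector junction `SectorComplement :
Target-text → Langlands` removed (the route's `Target` is verbatim the junction's hypothesis), so that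
an ITEM of the route concludes `Target` BY NAME: for a non-CM elliptic curve `E` over an imaginary
quadratic `F`, case split at `p = 5` on «`E[5] ⊗ F` irreducible» (`IrreducibleFiveModular`), else on
the existence of an irreducible ordinary 5-adic avatar (`hA`) and of an oriented integral model
(`hB`): oriented ⇒ `OrientedOrdinaryOfEngine` fed by `ReducibleOrdinaryModular`; unoriented ⇒
`UnorientedOrdinaryModular`; no ordinary avatar ⇒ `NonOrdinaryEisensteinModular`.  No Literature
named fact is consumed; axioms `propext`, `Classical.choice`, `Quot.sound`. -/

set_option linter.dupNamespace false

namespace Summit.Langlands.Langlands.Theorems.FifteenLocusEisensteinTargetOfCruxes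

open Summit.Langlands.Langlands.Theses.FifteenLocusEisenstein

/-- **stmt-Langlands-15890** `FifteenLocusEisenstein.TargetOfCruxes`: the five cruxes imply the
route's `Target` (the body of `closes` without the sector junction). -/
theorem targetOfCruxes : TargetOfCruxes := by
  intro h1 h3 h2 hE h4 F _ _ htc hdeg E hΔ hcm hcpt
  haveI h5 : Fact (Nat.Prime 5) := ⟨by norm_num⟩
  by_cases hirr : (E.baseChange F).HasIrreducibleModPGaloisRep 5
  · exact h1 F htc hdeg E hΔ hcm hirr hcpt
  · by_cases hA :
        (∃ ρ : Literature.NumberTheory.GaloisRepresentations.FramedGaloisRep F (PadicAlgCl 5) 2,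
          (ρ.toGaloisRep.IsIrreducible ∧ ∀ᶠ w : IsDedekindDomain.HeightOneSpectrum
          (NumberField.RingOfIntegers F) in Filter.cofinite, ρ.IsUnramifiedAt w ∧ ρ.HasFrobCharpolyAt w
          (Polynomial.X ^ 2 - Polynomial.C ((Literature.NumberTheory.Automorphic.frobTraceAt E w : ℤ) :
          PadicAlgCl 5) * Polynomial.X + Polynomial.C ((w.residueCard : ℕ) : PadicAlgCl 5))) ∧ ∀ v :
          IsDedekindDomain.HeightOneSpectrum (NumberField.RingOfIntegers F), ((5 : ℕ) :
          NumberField.RingOfIntegers F) ∈ v.asIdeal → ∃ m : ℕ, 0 < m ∧ ρ.IsOrdinaryOfWeightAt 5 v 2 m)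
    · by_cases hB :
          (∃ (O : ValuationSubring (PadicAlgCl 5)) (ρ :
            Literature.NumberTheory.GaloisRepresentations.FramedGaloisRep F (PadicAlgCl 5) 2) (ρ₀ :
            Field.absoluteGaloisGroup F →* Matrix.GeneralLinearGroup (Fin 2) O), O = (Valued.v : Valuation
            (PadicAlgCl 5) NNReal).valuationSubring ∧ (ρ.toGaloisRep.IsIrreducible ∧ ∀ᶠ w :
            IsDedekindDomain.HeightOneSpectrum (NumberField.RingOfIntegers F) in Filter.cofinite,
            ρ.IsUnramifiedAt w ∧ ρ.HasFrobCharpolyAt w (Polynomial.X ^ 2 - Polynomial.C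
            ((Literature.NumberTheory.Automorphic.frobTraceAt E w : ℤ) : PadicAlgCl 5) * Polynomial.X +
            Polynomial.C ((w.residueCard : ℕ) : PadicAlgCl 5))) ∧ ρ.HasUpperTriangularIntegralModel ρ₀ ∧ ∃
            m : ℕ, 0 < m ∧ ∀ v : IsDedekindDomain.HeightOneSpectrum (NumberField.RingOfIntegers F), ((5 :
            ℕ) : NumberField.RingOfIntegers F) ∈ v.asIdeal →
            Literature.NumberTheory.GaloisRepresentations.IsPDistinguishedAt ρ₀ v ∧ ∃ Q :
            Matrix.GeneralLinearGroup (Fin 2) (PadicAlgCl 5), Valued.v (Q.val 0 0) ≤ Valued.v (Q.val 1 0) ∧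
            ∀ σ, (Q⁻¹ * ρ.toLocal v σ * Q).val 1 0 = 0 ∧ (σ ∈
            Literature.NumberTheory.GaloisRepresentations.absInertia (v.adicCompletion F) → (Q⁻¹ *
            ρ.toLocal v σ * Q).val 1 1 ^ m = 1 ∧ (Q⁻¹ * ρ.toLocal v σ * Q).val 0 0 ^ m = algebraMap (Padic
            5) (PadicAlgCl 5)
            (((Literature.NumberTheory.GaloisRepresentations.GaloisRep.cyclotomicCharacter
            (v.adicCompletion F) 5 σ).val : PadicInt 5) : Padic 5) ^ ((2 - 1) * m)))
      · exact h4 hE F htc hdeg 5 (by norm_num) E hΔ hcm hB hcpt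
      · exact h2 F htc hdeg 5 (by norm_num) E hΔ hcm hirr hA hB hcpt
    · exact h3 F htc hdeg 5 (by norm_num) E hΔ hcm hirr hA hcpt

end Summit.Langlands.Langlands.Theorems.FifteenLocusEisensteinTargetOfCruxes
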